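import Summits.QuantumFields.YangMills.Theorems.UnitScaleTiltProp7ProjRTopMeanCover
import Summits.QuantumFields.YangMills.Theorems.UnitScaleTiltProp7CoverTwistedChartSym
import HarnessLib

/-!
# Route `UnitScaleTilt`, crux K1 (stmt-QuantumFields-19200), EX row `hPcol` — SMALL MEMBERS VIA THE COVER: **THE LOD PROPAGATOR `G_a` IS NATURAL UNDER THE `L^{jc}`-FOLD COVER**,
# `G̃_a(f∘π) = (G_a f)∘π`, hence the two `ℓ^∞ → ℓ^∞` letters of the hPcol knit (`hGsup : ‖G_a f‖_∞ ≤ B_∞‖f‖_∞`, `hT1 : ‖D_{U₀}G_a f‖_∞ ≤ R₁‖f‖_∞`) DESCEND from the cover member to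
# the member with the SAME constants (no fibre sum: sup rows) — the road for the members where the gradient knit's no-wrap room `2(12·L^{K−n}+5) ≤ sitesPerDir 0` fails
# (px5 g13 «GO — IT IS YOURS» 07:56:40Z; px10 g12's `hPcol_allMembers_exists` consumes the NO-ROOM edition BY NAME).

Cell `ym3-torus` (rung R3 = SU(2) YM₃ on T³ — NOT d = 4, NOT infinite volume, NOT a mass gap, NOT Clay); width seat `ym3-torus-px12` (gen 16).  THEOREMS ONLY (0 `def`, 0 `sorry`,
default heartbeats); `--supports stmt-QuantumFields-19200 --as helper`; count-neutral.

WHY ∕ HOW.  The member's LOD data `(Q″, ι, T, G)` and the cover member's `(Q″_c, ι_c, T_c, G_c)` (top nested covariant means OF RECORD at `U₀` resp. `U₀∘π`, the coarse lift `ι`, the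
adjoint `T = (ιQ″)†`, the two-sided inverse `G = (Δ^η + a·TιQ″)⁻¹`) intertwine with the pullback `π*`: `Δ^η` by (c2)'s ✓`Prop7CoverHilbertPullback.covLapSite_cover`, `Q″` by
✓`Prop7TopMeanCoverNaturality.topMean_cover`, `ι` by px17's ✓`proj_siteShift`, and `T` by ADJUNCTION: `π*` and the fibre sum `π_*` are adjoint (✓`Prop7CoverCombLetters.inner_pull_eq_inner_push`
at the fine levels of `F, K` and `F, n`) and `ιQ″` commutes with `π_*` (✓`topMean_push` + the fibre reindexing along `siteShift`) — so `T_c(π*g) = π*(Tg)`.  Then `u := π*(G f)` solves the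
cover equation with source `π*f`, and the two-sided inverse `G_c` gives `G_c(π*f) = u` (§2).  Sups are read through the lift (`toL2S_apply`, ✓`DL2_cover'`, ✓`proj_surjective`) (§3).
Print: the constants of [Balaban1985BackgroundPropagators] Thm 3.1 «do not depend on {Ω_j}» (p.399 L1–3), read on the cover.

WHAT IS PROVED (ns `…Theorems.Prop7MassiveSolutionOfCover`; data VERBATIM in V4∕V6's letters at the member (`Q₀ hseq₀ ι₀ hι₀ T₀ hT₀ G₀ hAG₀`) and at the cover member
(`Q₁ hseq₁ ι₁ hι₁ T₁ hT₁ G₁ hAG₁ hGA₁`), same mass `a`, weights `c₀ c₁`).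
* §1 `siteLift_apply` ∕ `bondLift_apply` (values of a lift) · ★`topMean_lift` · ★`iota_lift` · ★★`push_iota_topMean` (`π_*∘ι_cQ″_c = ιQ″∘π_*`) · ★★`T_lift` (`T_c(π*g) = π*(T g)`).
* §2 ★★★ `massiveInverse_lift` — `G_c (π* f) = π* (G f)`.
* §3 ★★★ `hGsup_of_cover` · ★★★ `hT1_of_cover` — the hPcol knit's letters at the MEMBER from the same letters at the COVER MEMBER, constants `Bv`, `R₁` UNCHANGED.
HYP-SAT (★★OWNER RULING №42).  All hypotheses are the LOD data clauses of record (inhabited at both members by ✓`exists_intertwiner_of_regPr` (iii), `rfl`, `LinearMap.adjoint`,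
✓`exists_massive_inverse`) and the cover member's two letters (inhabited by ✓`Prop7MassiveSolutionGradientSupOfRegPr.hGsup_of_regPr`∕`hT1_of_regPr` at `F.cover 3`, where the room
holds by ✓`Prop7KernelRow349OfCover.room_cover`); conclusions non-vacuous; no `Prop` hypothesis restates them.
HONEST SCOPE.  Identities + sup bookkeeping; nothing of hPcol ∕ its AllMembers package ∕ the ten EX rows ∕ EX ∕ the crux is proved here; the Yang–Mills mass gap is NOT proved.

References: T. Bałaban, CMP **99** (1985) 389–434 [Balaban1985BackgroundPropagators] ((3.19)–(3.25) pp.393–394, Thm 3.1 p.397, p.399 L1–3);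
CMP **96** (1984) 223–250 [Balaban1984PropagatorsII] ((2.15)–(2.19) pp.225–226); CMP **109** (1987) 249–301 [Balaban1987RG1] ((0.1)–(0.3) pp.251–252).
-/

set_option autoImplicit false

noncomputable section

open scoped BigOperators Matrix.Norms.L2Operator InnerProductSpace ComplexConjugate

namespace Summit.QuantumFields.YangMills.Theorems.Prop7MassiveSolutionOfCover

open Literature.MathematicalPhysics.QuantumFieldTheory.Balaban1983to89
open Literature.MathematicalPhysics.QuantumFieldTheory.Balaban1983to89.T3ContinuumYM3Torus
open T4Continuum BlockAveraging
open BlockAveraging (Idx)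
open B7Prop1Explicit (disp)
open B10Eq27TorusAxialLog (holT transl)
open B7TransferAnalyticMean (meanCLM)
open B4Sect5Torus (TSite)
open B9SectCLatticeCarrier (Bond)
open B9Eq311L2Pairing (WL2)
open B11Eq103H1Complex (SiteL2K)
open T3SectALandauChart (bgUnits)
open T3PrintedRegularOrbits (sites_eq)
open T3LevelShift (siteShift)
open Summit.QuantumFields.YangMills.Theorems.Prop8Chart (emlIterU)
open Summit.QuantumFields.YangMills.Theorems.Prop7SectET3Transport (periodsT3 siteEquiv bondEquiv)
open Summit.QuantumFields.YangMills.Theorems.Prop7SectET3HilbertLetters (W₂ frobEquiv toL2 toL2S DL2 covLapSite toL2S_apply toL2S_symm_apply toL2_apply toL2_symm_apply)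
open Summit.QuantumFields.YangMills.Theorems.CoverSites
open Summit.QuantumFields.YangMills.Theorems.Prop7CoverHilbertPullback (covLapSite_cover DL2_cover')
open Summit.QuantumFields.YangMills.Theorems.Prop7CoverCombLetters (inner_pull_eq_inner_push)
open Summit.QuantumFields.YangMills.Theorems.Prop7TopMeanCoverNaturality (topMean_cover topMean_push)
open Summit.QuantumFields.YangMills.Theorems.Prop7CoverTwistedChartSym (proj_siteShift)

variable (F : T3Family) (jc : ℕ) {n K : ℕ} (h : n ≤ K) (c₀ : ℝ) [Fact (0 < c₀)] {c₁ : ℝ} [Fact (0 < c₁)]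
  (U₀ : GaugeField (F.P K) 0 (Matrix.specialUnitaryGroup (Fin 2) ℂ))
  -- the member's LOD data
  (Q₀ : SiteL2K ℂ 3 (periodsT3 F K) c₀ W₂ →ₗ[ℂ] (Site (F.P K) (K - n) → Matrix (Fin 2) (Fin 2) ℂ))
  (hseq₀ : ∀ lam : Site (F.P K) 0 → Matrix (Fin 2) (Fin 2) ℂ, ∃ ns : (j : ℕ) → Site (F.P K) j → Matrix (Fin 2) (Fin 2) ℂ, ns 0 = lam ∧
    (∀ (j : ℕ) (y : Site (F.P K) (j + 1)), ns (j + 1) y = ns j (emb y) - meanCLM (Idx (F.P K)) (Matrix (Fin 2) (Fin 2) ℂ) fun i : Idx (F.P K) =>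
      ns j (emb y) - ((holT (emlIterU j (bgUnits F K U₀)) (emb y) (stairWord i.2.1 (off i.1)) : (Matrix (Fin 2) (Fin 2) ℂ)ˣ) : Matrix (Fin 2) (Fin 2) ℂ) *
        ns j (transl (emb y) (disp (stairWord i.2.1 (off i.1)))) * (((holT (emlIterU j (bgUnits F K U₀)) (emb y) (stairWord i.2.1 (off i.1)))⁻¹ : (Matrix (Fin 2) (Fin 2) ℂ)ˣ) : Matrix (Fin 2) (Fin 2) ℂ)) ∧
    ns (K - n) = Q₀ (toL2S F K c₀ lam))
  (ι₀ : (Site (F.P K) (K - n) → Matrix (Fin 2) (Fin 2) ℂ) →ₗ[ℂ] SiteL2K ℂ 3 (periodsT3 F n) c₁ W₂)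
  (hι₀ : ∀ c, ι₀ c = toL2S F n c₁ (fun z => c (siteShift (sites_eq F n K h) z)))
  (T₀ : SiteL2K ℂ 3 (periodsT3 F n) c₁ W₂ →ₗ[ℂ] SiteL2K ℂ 3 (periodsT3 F K) c₀ W₂)
  (hT₀ : ∀ (l : SiteL2K ℂ 3 (periodsT3 F K) c₀ W₂) (f : SiteL2K ℂ 3 (periodsT3 F n) c₁ W₂), ⟪ι₀ (Q₀ l), f⟫_ℂ = ⟪l, T₀ f⟫_ℂ)
  -- the cover member's LOD data
  (Q₁ : SiteL2K ℂ 3 (periodsT3 (F.cover jc) K) c₀ W₂ →ₗ[ℂ] (Site ((F.cover jc).P K) (K - n) → Matrix (Fin 2) (Fin 2) ℂ))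
  (hseq₁ : ∀ lam : Site ((F.cover jc).P K) 0 → Matrix (Fin 2) (Fin 2) ℂ, ∃ ns : (j : ℕ) → Site ((F.cover jc).P K) j → Matrix (Fin 2) (Fin 2) ℂ, ns 0 = lam ∧
    (∀ (j : ℕ) (y : Site ((F.cover jc).P K) (j + 1)), ns (j + 1) y = ns j (emb y) - meanCLM (Idx ((F.cover jc).P K)) (Matrix (Fin 2) (Fin 2) ℂ) fun i : Idx ((F.cover jc).P K) =>
      ns j (emb y) - ((holT (emlIterU j (bgUnits (F.cover jc) K (U₀ ∘ projBond (F.P K) jc 0))) (emb y) (stairWord i.2.1 (off i.1)) : (Matrix (Fin 2) (Fin 2) ℂ)ˣ) : Matrix (Fin 2) (Fin 2) ℂ) *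
        ns j (transl (emb y) (disp (stairWord i.2.1 (off i.1)))) *
          (((holT (emlIterU j (bgUnits (F.cover jc) K (U₀ ∘ projBond (F.P K) jc 0))) (emb y) (stairWord i.2.1 (off i.1)))⁻¹ : (Matrix (Fin 2) (Fin 2) ℂ)ˣ) : Matrix (Fin 2) (Fin 2) ℂ)) ∧
    ns (K - n) = Q₁ (toL2S (F.cover jc) K c₀ lam))
  (ι₁ : (Site ((F.cover jc).P K) (K - n) → Matrix (Fin 2) (Fin 2) ℂ) →ₗ[ℂ] SiteL2K ℂ 3 (periodsT3 (F.cover jc) n) c₁ W₂)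
  (hι₁ : ∀ c, ι₁ c = toL2S (F.cover jc) n c₁ (fun z => c (siteShift (sites_eq (F.cover jc) n K h) z)))
  (T₁ : SiteL2K ℂ 3 (periodsT3 (F.cover jc) n) c₁ W₂ →ₗ[ℂ] SiteL2K ℂ 3 (periodsT3 (F.cover jc) K) c₀ W₂)
  (hT₁ : ∀ (l : SiteL2K ℂ 3 (periodsT3 (F.cover jc) K) c₀ W₂) (f : SiteL2K ℂ 3 (periodsT3 (F.cover jc) n) c₁ W₂), ⟪ι₁ (Q₁ l), f⟫_ℂ = ⟪l, T₁ f⟫_ℂ)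

/-! ## §1 The naturality dictionary -/

omit [Fact (0 < c₀)] in
/-- Values of a lift: `(π*l)(y) = l(π y)` in the `WL2` reading. [cite: Balaban1984PropagatorsII, (2.15) p.225] -/
theorem siteLift_apply (l : Site (F.P K) 0 → Matrix (Fin 2) (Fin 2) ℂ) (yt : TSite 3 (periodsT3 (F.cover jc) K)) :
    WL2.equiv ℂ _ W₂ (toL2S (F.cover jc) K c₀ (l ∘ proj (F.P K) jc 0)) yt
      = WL2.equiv ℂ _ W₂ (toL2S F K c₀ l) (siteEquiv F K (proj (F.P K) jc 0 ((siteEquiv (F.cover jc) K).symm yt))) := by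
  rw [toL2S_apply, toL2S_apply, Equiv.symm_apply_apply, Function.comp_apply]

omit [Fact (0 < c₀)] in
/-- Values of a lifted bond field: `(π*X)(p) = X(π p)`. [cite: Balaban1984PropagatorsII, (2.15) p.225] -/
theorem bondLift_apply (X : PBond (F.P K) 0 → Matrix (Fin 2) (Fin 2) ℂ) (p : Bond 3 (periodsT3 (F.cover jc) K)) :
    WL2.equiv ℂ _ W₂ (toL2 (F.cover jc) K c₀ (X ∘ projBond (F.P K) jc 0)) p
      = WL2.equiv ℂ _ W₂ (toL2 F K c₀ X) (bondEquiv F K (projBond (F.P K) jc 0 ((bondEquiv (F.cover jc) K).symm p))) := by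
  rw [toL2_apply, toL2_apply, Equiv.symm_apply_apply, Function.comp_apply]

include h hseq₀ hseq₁ in
omit [Fact (0 < c₀)] in
/-- ★ **`Q″_c(π*λ) = (Q″λ) ∘ π`** as coarse functions (✓`topMean_cover`). [cite: Balaban1985BackgroundPropagators, (3.19) p.393] -/
theorem topMean_lift (l : Site (F.P K) 0 → Matrix (Fin 2) (Fin 2) ℂ) :
    Q₁ (toL2S (F.cover jc) K c₀ (l ∘ proj (F.P K) jc 0)) = Q₀ (toL2S F K c₀ l) ∘ proj (F.P K) jc (K - n) := by
  funext yt
  exact topMean_cover F jc h U₀ Q₀ hseq₀ Q₁ hseq₁ l yt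

include hι₀ hι₁ in
omit [Fact (0 < c₀)] [Fact (0 < c₁)] in
/-- ★ **`ι_c(c ∘ π) = π*(ι c)`** (px17 ✓`proj_siteShift`). [cite: Balaban1985BackgroundPropagators, (3.24) p.394] -/
theorem iota_lift (c : Site (F.P K) (K - n) → Matrix (Fin 2) (Fin 2) ℂ) :
    ι₁ (c ∘ proj (F.P K) jc (K - n)) = toL2S (F.cover jc) n c₁ ((toL2S F n c₁).symm (ι₀ c) ∘ proj (F.P n) jc 0) := by
  rw [hι₁, hι₀, LinearEquiv.symm_apply_apply]
  congr 1
  funext z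
  simp only [Function.comp_apply, proj_siteShift F jc h]

include h hseq₀ hseq₁ hι₀ hι₁ in
omit [Fact (0 < c₀)] [Fact (0 < c₁)] in
/-- ★★ **`π_* ∘ (ι_cQ″_c) = (ιQ″) ∘ π_*`** — the coarse lift of the top mean commutes with the FIBRE SUM: ✓`topMean_push` on `Q″` and the reindexing of the fine fibre over
`z` along the level shift `siteShift` (a bijection onto the coarse fibre over `siteShift z`, ✓`proj_siteShift`). [cite: Balaban1984PropagatorsII, (2.17) p.225] -/
theorem push_iota_topMean (g : Site ((F.cover jc).P K) 0 → Matrix (Fin 2) (Fin 2) ℂ) :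
    push (F.P n) jc 0 ((toL2S (F.cover jc) n c₁).symm (ι₁ (Q₁ (toL2S (F.cover jc) K c₀ g))))
      = (toL2S F n c₁).symm (ι₀ (Q₀ (toL2S F K c₀ (push (F.P K) jc 0 g)))) := by
  classical
  funext z
  rw [hι₁, hι₀, LinearEquiv.symm_apply_apply, LinearEquiv.symm_apply_apply, push_apply, topMean_push F jc h U₀ Q₀ hseq₀ Q₁ hseq₁ g, push_apply]
  -- reindex the fibre over `z` (fine, member `F, n`) onto the fibre over `siteShift z` (coarse level `K − n` of member `F, K`)
  have hk : ∀ zt : Site ((F.cover jc).P n) 0,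
      proj (F.P K) jc (K - n) (siteShift (sites_eq (F.cover jc) n K h) zt) = siteShift (sites_eq F n K h) (proj (F.P n) jc 0 zt) :=
    fun zt => proj_siteShift F jc h zt
  refine Finset.sum_equiv (siteShift (sites_eq (F.cover jc) n K h)) (fun zt => ?_) (fun zt _ => rfl)
  simp only [Finset.mem_filter, Finset.mem_univ, true_and]
  constructor
  · intro hz
    exact (hk zt).trans (by rw [hz])
  · intro hE
    exact (siteShift (sites_eq F n K h)).injective ((hk zt).symm.trans hE)

include h hseq₀ hseq₁ hι₀ hι₁ hT₀ hT₁ in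
/-- ★★ **`T_c(π*g) = π*(T g)`** — the adjoint of the lifted coarse mean is natural under the pullback, by ADJUNCTION: `⟪v, T_c(π*g)⟫ = ⟪ι_cQ″_c v, π*g⟫ = ⟪π_*(ι_cQ″_c v), g⟫
= ⟪ιQ″(π_* v), g⟫ = ⟪π_* v, Tg⟫ = ⟪v, π*(Tg)⟫` (✓`inner_pull_eq_inner_push` twice, `push_iota_topMean`). [cite: Balaban1984PropagatorsII, (2.15)–(2.19) pp.225–226] -/
theorem T_lift (g : SiteL2K ℂ 3 (periodsT3 F n) c₁ W₂) :
    T₁ (toL2S (F.cover jc) n c₁ ((toL2S F n c₁).symm g ∘ proj (F.P n) jc 0))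
      = toL2S (F.cover jc) K c₀ ((toL2S F K c₀).symm (T₀ g) ∘ proj (F.P K) jc 0) := by
  refine ext_inner_left ℂ fun v => ?_
  obtain ⟨l', rfl⟩ := (toL2S (F.cover jc) K c₀).surjective v
  -- left: through `hT₁`, the level-`n` adjunction and `push_iota_topMean`
  have hL : ⟪toL2S (F.cover jc) K c₀ l', T₁ (toL2S (F.cover jc) n c₁ ((toL2S F n c₁).symm g ∘ proj (F.P n) jc 0))⟫_ℂ
      = ⟪ι₀ (Q₀ (toL2S F K c₀ (push (F.P K) jc 0 l'))), g⟫_ℂ := by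
    rw [← hT₁, ← inner_conj_symm, ← (toL2S (F.cover jc) n c₁).apply_symm_apply (ι₁ (Q₁ (toL2S (F.cover jc) K c₀ l'))),
      inner_pull_eq_inner_push F jc n c₁, push_iota_topMean F jc h c₀ U₀ Q₀ hseq₀ ι₀ hι₀ Q₁ hseq₁ ι₁ hι₁ l',
      LinearEquiv.apply_symm_apply, LinearEquiv.apply_symm_apply, inner_conj_symm]
  -- right: the level-`K` adjunction and `hT₀`
  have hR : ⟪toL2S (F.cover jc) K c₀ l', toL2S (F.cover jc) K c₀ ((toL2S F K c₀).symm (T₀ g) ∘ proj (F.P K) jc 0)⟫_ℂ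
      = ⟪ι₀ (Q₀ (toL2S F K c₀ (push (F.P K) jc 0 l'))), g⟫_ℂ := by
    rw [← inner_conj_symm, inner_pull_eq_inner_push F jc K c₀, LinearEquiv.apply_symm_apply, inner_conj_symm, hT₀]
  rw [hL, hR]

/-! ## §2 The LOD propagator is natural under the pullback -/

include h hseq₀ hseq₁ hι₀ hι₁ hT₀ hT₁ in
/-- ★★★ **`G_c(π*f) = π*(G f)` — THE LOD PROPAGATOR `G_a = (Δ^η + a·TιQ″)⁻¹` IS NATURAL UNDER THE `L^{jc}`-FOLD COVER**: `u := π*(G f)` solves the cover member's equation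
with source `π*f` (✓`covLapSite_cover`, `topMean_lift`, `iota_lift`, `T_lift`, the member's `hAG`), and the cover member's two-sided inverse returns `u` (`hGA` on the cover).
[cite: Balaban1985BackgroundPropagators, (3.23)–(3.25) p.394, p.399 L1–3; Balaban1984PropagatorsII, (2.16)–(2.19) pp.225–226] -/
theorem massiveInverse_lift (a : ℝ)
    (G₀ : SiteL2K ℂ 3 (periodsT3 F K) c₀ W₂ →ₗ[ℂ] SiteL2K ℂ 3 (periodsT3 F K) c₀ W₂)
    (hAG₀ : ∀ f, covLapSite F n K c₀ U₀ (G₀ f) + (a : ℂ) • T₀ (ι₀ (Q₀ (G₀ f))) = f)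
    (G₁ : SiteL2K ℂ 3 (periodsT3 (F.cover jc) K) c₀ W₂ →ₗ[ℂ] SiteL2K ℂ 3 (periodsT3 (F.cover jc) K) c₀ W₂)
    (hGA₁ : ∀ u, G₁ (covLapSite (F.cover jc) n K c₀ (U₀ ∘ projBond (F.P K) jc 0) u + (a : ℂ) • T₁ (ι₁ (Q₁ u))) = u)
    (f : SiteL2K ℂ 3 (periodsT3 F K) c₀ W₂) :
    G₁ (toL2S (F.cover jc) K c₀ ((toL2S F K c₀).symm f ∘ proj (F.P K) jc 0))
      = toL2S (F.cover jc) K c₀ ((toL2S F K c₀).symm (G₀ f) ∘ proj (F.P K) jc 0) := by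
  set l : Site (F.P K) 0 → Matrix (Fin 2) (Fin 2) ℂ := (toL2S F K c₀).symm (G₀ f) with hl
  have hGl : toL2S F K c₀ l = G₀ f := (toL2S F K c₀).apply_symm_apply _
  -- the four naturality rows at `u := π*(G f)`
  have hΔ := covLapSite_cover F jc n K c₀ U₀ l
  have hQ := topMean_lift F jc h c₀ U₀ Q₀ hseq₀ Q₁ hseq₁ l
  have hι := iota_lift F jc h ι₀ hι₀ ι₁ hι₁ (Q₀ (toL2S F K c₀ l))
  have hT := T_lift F jc h c₀ U₀ Q₀ hseq₀ ι₀ hι₀ T₀ hT₀ Q₁ hseq₁ ι₁ hι₁ T₁ hT₁ (ι₀ (Q₀ (toL2S F K c₀ l)))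
  -- the penalty term of the lifted field is the lift of the penalty term
  have e1 : T₁ (ι₁ (Q₁ (toL2S (F.cover jc) K c₀ (l ∘ proj (F.P K) jc 0))))
      = toL2S (F.cover jc) K c₀ ((toL2S F K c₀).symm (T₀ (ι₀ (Q₀ (toL2S F K c₀ l)))) ∘ proj (F.P K) jc 0) := by
    have e0 : ι₁ (Q₁ (toL2S (F.cover jc) K c₀ (l ∘ proj (F.P K) jc 0)))
        = toL2S (F.cover jc) n c₁ ((toL2S F n c₁).symm (ι₀ (Q₀ (toL2S F K c₀ l))) ∘ proj (F.P n) jc 0) :=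
      (congrArg ι₁ hQ).trans hι
    exact (congrArg T₁ e0).trans hT
  -- the cover equation with source `π*f`
  have hsum : covLapSite (F.cover jc) n K c₀ (U₀ ∘ projBond (F.P K) jc 0) (toL2S (F.cover jc) K c₀ (l ∘ proj (F.P K) jc 0))
      + (a : ℂ) • T₁ (ι₁ (Q₁ (toL2S (F.cover jc) K c₀ (l ∘ proj (F.P K) jc 0))))
      = toL2S (F.cover jc) K c₀ ((toL2S F K c₀).symm f ∘ proj (F.P K) jc 0) := by
    rw [hΔ, e1, ← map_smul, ← map_add]
    congr 1
    have hf : (toL2S F K c₀).symm f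
        = (toL2S F K c₀).symm (covLapSite F n K c₀ U₀ (toL2S F K c₀ l)) + (a : ℂ) • (toL2S F K c₀).symm (T₀ (ι₀ (Q₀ (toL2S F K c₀ l)))) := by
      rw [← map_smul, ← map_add, hGl, hAG₀]
    rw [hf]
    rfl
  rw [← hsum, hGA₁]

/-! ## §3 The two `ℓ^∞ → ℓ^∞` letters of the hPcol knit descend with the same constants -/

include h hseq₀ hseq₁ hι₀ hι₁ hT₀ hT₁ in
/-- ★★★ **`hGsup` DESCENDS**: if the cover member's LOD propagator obeys `‖G_c f̃‖_∞ ≤ B_∞·‖f̃‖_∞` for every bounded `f̃`, then so does the member's, SAME `B_∞` — P4's `hGsup` letter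
(✓`Prop7PcolOfGradientRow`) at the MEMBER from the same letter at `F.cover jc` (inhabited there, with room, by ✓`Prop7MassiveSolutionGradientSupOfRegPr.hGsup_of_regPr`).
[cite: Balaban1985BackgroundPropagators, Thm 3.1 (3.42) p.397, p.399 L1–3] -/
theorem hGsup_of_cover (a : ℝ)
    (G₀ : SiteL2K ℂ 3 (periodsT3 F K) c₀ W₂ →ₗ[ℂ] SiteL2K ℂ 3 (periodsT3 F K) c₀ W₂)
    (hAG₀ : ∀ f, covLapSite F n K c₀ U₀ (G₀ f) + (a : ℂ) • T₀ (ι₀ (Q₀ (G₀ f))) = f)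
    (G₁ : SiteL2K ℂ 3 (periodsT3 (F.cover jc) K) c₀ W₂ →ₗ[ℂ] SiteL2K ℂ 3 (periodsT3 (F.cover jc) K) c₀ W₂)
    (hGA₁ : ∀ u, G₁ (covLapSite (F.cover jc) n K c₀ (U₀ ∘ projBond (F.P K) jc 0) u + (a : ℂ) • T₁ (ι₁ (Q₁ u))) = u)
    {Bv : ℝ}
    (hGc : ∀ (f : SiteL2K ℂ 3 (periodsT3 (F.cover jc) K) c₀ W₂) (Fb : ℝ), (∀ y, ‖WL2.equiv ℂ _ W₂ f y‖ ≤ Fb) →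
      ∀ y, ‖WL2.equiv ℂ _ W₂ (G₁ f) y‖ ≤ Bv * Fb) :
    ∀ (f : SiteL2K ℂ 3 (periodsT3 F K) c₀ W₂) (Fb : ℝ), (∀ y, ‖WL2.equiv ℂ _ W₂ f y‖ ≤ Fb) →
      ∀ y, ‖WL2.equiv ℂ _ W₂ (G₀ f) y‖ ≤ Bv * Fb := by
  intro f Fb hf y
  -- the lift of `f` is bounded by `Fb`
  have hlift : ∀ yt, ‖WL2.equiv ℂ _ W₂ (toL2S (F.cover jc) K c₀ ((toL2S F K c₀).symm f ∘ proj (F.P K) jc 0)) yt‖ ≤ Fb := by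
    intro yt
    rw [siteLift_apply, LinearEquiv.apply_symm_apply]
    exact hf _
  have hG := hGc _ Fb hlift
  -- read `(G f)(y)` through a lift of `y`
  obtain ⟨x, rfl⟩ := (siteEquiv F K).surjective y
  obtain ⟨xt, hxt⟩ := proj_surjective (F.P K) jc 0 x
  have e := siteLift_apply F jc c₀ ((toL2S F K c₀).symm (G₀ f)) (siteEquiv (F.cover jc) K xt)
  rw [Equiv.symm_apply_apply, hxt, LinearEquiv.apply_symm_apply] at e
  rw [← e, ← massiveInverse_lift F jc h c₀ U₀ Q₀ hseq₀ ι₀ hι₀ T₀ hT₀ Q₁ hseq₁ ι₁ hι₁ T₁ hT₁ a G₀ hAG₀ G₁ hGA₁ f]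
  exact hG _

include h hseq₀ hseq₁ hι₀ hι₁ hT₀ hT₁ in
/-- ★★★ **`hT1` DESCENDS**: if the cover member obeys `‖D_{U₀∘π}(G_c f̃)‖_∞ ≤ R₁·‖f̃‖_∞` for every bounded `f̃`, then the member obeys `‖D_{U₀}(G f)‖_∞ ≤ R₁·‖f‖_∞`, SAME `R₁`
— P4's `hT1` letter at the MEMBER from the same letter at `F.cover jc` (inhabited there, with room, by ✓`Prop7MassiveSolutionGradientSupOfRegPr.hT1_of_regPr`); the gradient is read
through ✓`DL2_cover'`. [cite: Balaban1985BackgroundPropagators, Thm 3.1 (3.42)–(3.44) pp.397–398, p.399 L1–3] -/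
theorem hT1_of_cover (a : ℝ)
    (G₀ : SiteL2K ℂ 3 (periodsT3 F K) c₀ W₂ →ₗ[ℂ] SiteL2K ℂ 3 (periodsT3 F K) c₀ W₂)
    (hAG₀ : ∀ f, covLapSite F n K c₀ U₀ (G₀ f) + (a : ℂ) • T₀ (ι₀ (Q₀ (G₀ f))) = f)
    (G₁ : SiteL2K ℂ 3 (periodsT3 (F.cover jc) K) c₀ W₂ →ₗ[ℂ] SiteL2K ℂ 3 (periodsT3 (F.cover jc) K) c₀ W₂)
    (hGA₁ : ∀ u, G₁ (covLapSite (F.cover jc) n K c₀ (U₀ ∘ projBond (F.P K) jc 0) u + (a : ℂ) • T₁ (ι₁ (Q₁ u))) = u)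
    {R₁ : ℝ}
    (hTc : ∀ (f : SiteL2K ℂ 3 (periodsT3 (F.cover jc) K) c₀ W₂) (Fb : ℝ), (∀ y, ‖WL2.equiv ℂ _ W₂ f y‖ ≤ Fb) →
      ∀ p : Bond 3 (periodsT3 (F.cover jc) K), ‖WL2.equiv ℂ _ W₂ (DL2 (F.cover jc) n K c₀ (U₀ ∘ projBond (F.P K) jc 0) (G₁ f)) p‖ ≤ R₁ * Fb) :
    ∀ (f : SiteL2K ℂ 3 (periodsT3 F K) c₀ W₂) (Fb : ℝ), (∀ y, ‖WL2.equiv ℂ _ W₂ f y‖ ≤ Fb) →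
      ∀ p : Bond 3 (periodsT3 F K), ‖WL2.equiv ℂ _ W₂ (DL2 F n K c₀ U₀ (G₀ f)) p‖ ≤ R₁ * Fb := by
  intro f Fb hf p
  have hlift : ∀ yt, ‖WL2.equiv ℂ _ W₂ (toL2S (F.cover jc) K c₀ ((toL2S F K c₀).symm f ∘ proj (F.P K) jc 0)) yt‖ ≤ Fb := by
    intro yt
    rw [siteLift_apply, LinearEquiv.apply_symm_apply]
    exact hf _
  have hD := hTc _ Fb hlift
  -- read `(D_{U₀}(G f))(p)` through a lift of `p`
  obtain ⟨b, rfl⟩ := (bondEquiv F K).surjective p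
  obtain ⟨bt, hbt⟩ := projBond_surjective (F.P K) jc 0 b
  have e := bondLift_apply F jc c₀ ((toL2 F K c₀).symm (DL2 F n K c₀ U₀ (G₀ f))) (bondEquiv (F.cover jc) K bt)
  rw [Equiv.symm_apply_apply, hbt, LinearEquiv.apply_symm_apply] at e
  have hDl := DL2_cover' F jc n K c₀ U₀ ((toL2S F K c₀).symm (G₀ f))
  rw [LinearEquiv.apply_symm_apply] at hDl
  rw [← e, ← hDl, ← massiveInverse_lift F jc h c₀ U₀ Q₀ hseq₀ ι₀ hι₀ T₀ hT₀ Q₁ hseq₁ ι₁ hι₁ T₁ hT₁ a G₀ hAG₀ G₁ hGA₁ f]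
  exact hD _

end Summit.QuantumFields.YangMills.Theorems.Prop7MassiveSolutionOfCover

end
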